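import Summits.HodgeConjecture.HodgeConjecture.Theorems.F0AlbCmBettiLevelRecordTransport
import Literature.AlgebraicGeometry.HodgeTheory.HodgeTypeConjugateEmbedding
import Literature.AlgebraicGeometry.HodgeTheory.HodgeTypeExteriorProduct
import Literature.NumberTheory.Automorphic.Liu2021.AppendixC.BettiPinningHodgeSplit
import HarnessLib

/-!
# Crux `HLiu418`, line `F0_AlbCm` ∕ `F0_AlbCmS1bHodge`, stub `stub_S1_realisationHodge` — leg (α): the GS Betti levels embed
# Hecke-naturally into the record's `H¹((M_K ⊗_{F,ι₁} ℂ)(ℂ); ℂ)` WITH HODGE TYPES REVERSED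

Floor-0 programme P5 (Alb-CM), seat F0P5-p04 (g0) (the sign seat); item stmt-HodgeConjecture-24832 (`HCCMUnconditional.HLiu418`),
sub-sub-line `Cruxes/HLiu418/Lines/F0_AlbCmS1bHodge` (letter `S1RealisationHodgeShape`).  THEOREMS ONLY (no `def`, no named fact, no
instance, no `sorry`); the Deligne transport [Deligne1979Valeurs, 0.2.5] enters as the HYPOTHESIS `ConjEmbedding.isOfHodgeType_conj_iff`
(★ named fact, `Literature/AlgebraicGeometry/HodgeTheory/HodgeTypeConjugateEmbedding`).  HC_CM is proved only modulo the 7 printed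
citations until rung 0 closes; this file closes nothing by itself.

THE TYPED TRANSPORT.  F0P5-p01's ★ `BettiLevelRecordTransport.exists_bettiLevelRecordTransport` embeds the GS Betti level
`H¹_{B,ι₁}(A_K, ℂ)` (`A_K = Alb(M_K ⊗_c F)`, ★ `sec42DataGS`) into `H¹((M_K ⊗_{ι₁} ℂ)(ℂ); ℂ)` as `κ_M^* ∘ (Θ⁻¹)^* ∘ albaneseH1Cmp`, with
complex conjugation of points `κ_M` at the level of the CURVE `M_K`.  Hodge types cannot be read there: the tree's `IsOfHodgeType` asks
for a Hodge model, available for `Motives.IsSmoothProjective` (geometrically irreducible) schemes, and `M_K ⊗ ℂ` is a disjoint union of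
ball quotients.  This file realises the SAME KIND of transport with conjugation at the level of the ABELIAN VARIETY `A_K`:
  `tr′_K := (Θ″⁻¹)^* ∘ albaneseH1Cmp^{ῑ₁} ∘ κ_{A_K}`,
* `κ_{A_K} = ConjEmbedding.complexBettiConj ι₁ (A_K) 1 : H¹((A_K ⊗_{ι₁} ℂ)(ℂ)) ≅ H¹((A_K ⊗_{ῑ₁} ℂ)(ℂ))` (★; Hodge types REVERSED by the
  hypothesis [Deligne1979Valeurs, 0.2.5] — both complexifications of `A_K` are abelian varieties, ★ `isSmoothProjective_baseChange_complex`);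
* `albaneseH1Cmp^{ῑ₁} = ((α_{X_K})_x ⊗_{ῑ₁} ℂ)^*` [Liu2021, Lem. 2.4 (1)] along `ῑ₁` (★ `albaneseH1Cmp_natural`, injective for curves ★
  `sec42Data_injective_albaneseH1Cmp_of_n_eq_two`, both `τ′`-generic);
* `Θ″ : (M_K ⊗_c F) ⊗_{ῑ₁} ℂ ≅ M_K ⊗_{ι₁} ℂ` (★ `baseChangeHomObjIsoOfComp`, `ῑ₁ ∘ c = ι₁`; natural ★ `baseChangeHomObjIsoOfComp_comm`).
The two algebraic steps preserve Hodge types along EVERY test morphism `φ : Z ⟶ M_K ⊗_{ι₁} ℂ` from a smooth projective `Z` (★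
`IsOfHodgeType.map_of_isSmoothProjective` applied to the composite `φ ≫ Θ″⁻¹ ≫ (α_{X_K})_x`, never to the reducible `M_K ⊗ ℂ`), so:
HEAD `exists_bettiLevelRecordTransport_hodge` — `∃ tr′, (∀ K, Injective (tr′ K)) ∧ (Hecke clause VERBATIM as ★ p795773) ∧
∀ K y p q, y of type (p,q) on A_K ⊗_{ι₁} ℂ → ∀ Z d φ, φ^* (tr′_K y) of type (q,p) on Z`.  Consumer: the typed closer of `stub_S1_realisationHodge`
(M5-glue at `tr′`, test morphisms = the record's pieces `ι_q : X_q ⟶ M_K ⊗_{ι₁} ℂ`).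

## References
* [Liu2021] Y. Liu, *Fourier–Jacobi cycles and arithmetic relative trace formula*, Camb. J. Math. 9 (2021): Lem. 2.4 (1) (FJcycle.tex
  l. 1210–1228), §4.2 (l. 2064–2081), §D.2 (D.1).
* [Deligne1979Valeurs] P. Deligne, *Valeurs de fonctions L et périodes d'intégrales*, PSPM 33.2 (1979), 0.2.5 p. 315 (`F_∞ : H_σ ⥲ H_{cσ}`).
* [Deligne1982HodgeCycles] P. Deligne, *Hodge cycles on abelian varieties*, LNM 900 (1982), §1 p. 7.
* [VoisinHodgeI2002] C. Voisin, *Hodge Theory and Complex Algebraic Geometry I* (2002), §7.3.2 (pull-backs preserve `(p,q)`).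
* [GortzWedhorn2020] U. Görtz, T. Wedhorn, *Algebraic Geometry I*, 2nd ed. (2020), Prop. 4.16 (transitivity of base change).
-/

set_option autoImplicit false
set_option linter.dupNamespace false  -- `Summit.HodgeConjecture.HodgeConjecture` (D-0017 single-conjunct summit layout)

noncomputable section

open CategoryTheory CategoryTheory.Limits AlgebraicGeometry NumberField Function
open Literature.AlgebraicGeometry.Motives Literature.AlgebraicGeometry.HodgeTheory
open Literature.AlgebraicTopology.SingularHomology
open Literature.AlgebraicGeometry.ShimuraVarieties.UnitaryCanonicalModel
open Literature.NumberTheory.Automorphic Literature.NumberTheory.Automorphic.UnitaryGroup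
open Literature.NumberTheory.Automorphic.Liu2021 Literature.NumberTheory.Automorphic.Liu2021.AppendixC
open Summit.HodgeConjecture.CorCM (CMField)
open Summit.HodgeConjecture.CorCM.Lines.A3Liu418
open Summit.HodgeConjecture.CorCM.D2Bridge (albaneseH1Cmp albaneseH1Cmp_eq albaneseH1Cmp_natural AlbanesePieces
  nonempty_albanesePieces sec42Data_injective_albaneseH1Cmp_of_n_eq_two)

namespace Summit.HodgeConjecture.HodgeConjecture.Cruxes.HLiu418.BettiLevelRecordTransportHodge

/-! ## §1 The conjugate-model identification `Θ″ : (Y ⊗_c L) ⊗_{ῑ₁} ℂ ≅ Y ⊗_{ι₁} ℂ` on `H¹` -/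

section ConjModel

variable (L : Type) [Field L] [NumberField L] [IsCMField L] (ι₁ : L →+* ℂ)

/-- `ῑ₁ ∘ c = ι₁` for the complex conjugation `c` of a CM field (`conj (conj z) = z`). [cite: Deligne1982HodgeCycles, §1 (p. 7)] -/
theorem conjEmb_comp_cmConjRingHom : (ConjEmbedding.conjEmb ι₁).comp (cmConjRingHom L) = ι₁ :=
  RingHom.ext fun x => by
    simp only [RingHom.coe_comp, Function.comp_apply, embedding_cmConjRingHom, Complex.conj_conj]

/-- **Naturality of `(Θ″⁻¹)^*` on `H¹`**: for `f : Y ⟶ Y'` over `L` and `Θ″_Y : (Y ⊗_c L) ⊗_{ῑ₁} ℂ ≅ Y ⊗_{ι₁} ℂ` (★ `baseChangeHomObjIsoOfComp`),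
`(Θ″_Y⁻¹)^* ∘ ((f ⊗_c L) ⊗_{ῑ₁} ℂ)^* = (f ⊗_{ι₁} ℂ)^* ∘ (Θ″_{Y'}⁻¹)^*`. [cite: GortzWedhorn2020, Prop. 4.16] -/
theorem complexBetti_map_conjModelIso_inv_natural {Y Y' : SchemeOver L} (f : Y ⟶ Y') (i : ℕ)
    (z : complexBetti ((baseChangeHom (ConjEmbedding.conjEmb ι₁)).obj ((baseChangeHom (cmConjRingHom L)).obj Y')) i) :
    (complexBetti.map (baseChangeHomObjIsoOfComp (cmConjRingHom L) (ConjEmbedding.conjEmb ι₁) ι₁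
        (conjEmb_comp_cmConjRingHom L ι₁) Y).inv i).hom
      ((complexBetti.map ((baseChangeHom (ConjEmbedding.conjEmb ι₁)).map ((baseChangeHom (cmConjRingHom L)).map f)) i).hom z) =
    (complexBetti.map ((baseChangeHom ι₁).map f) i).hom
      ((complexBetti.map (baseChangeHomObjIsoOfComp (cmConjRingHom L) (ConjEmbedding.conjEmb ι₁) ι₁
        (conjEmb_comp_cmConjRingHom L ι₁) Y').inv i).hom z) := by
  have hΘ := baseChangeHomObjIsoOfComp_comm (cmConjRingHom L) (ConjEmbedding.conjEmb ι₁) ι₁ (conjEmb_comp_cmConjRingHom L ι₁) f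
  have hinv : (baseChangeHomObjIsoOfComp (cmConjRingHom L) (ConjEmbedding.conjEmb ι₁) ι₁ (conjEmb_comp_cmConjRingHom L ι₁) Y).inv ≫
      (baseChangeHom (ConjEmbedding.conjEmb ι₁)).map ((baseChangeHom (cmConjRingHom L)).map f) =
      (baseChangeHom ι₁).map f ≫
        (baseChangeHomObjIsoOfComp (cmConjRingHom L) (ConjEmbedding.conjEmb ι₁) ι₁ (conjEmb_comp_cmConjRingHom L ι₁) Y').inv := by
    rw [Iso.inv_comp_eq, ← Category.assoc, Iso.eq_comp_inv]
    exact hΘ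
  have hmap := congrArg (fun φ => (complexBetti.map φ i).hom z) hinv
  simp only [complexBetti.map_comp, ModuleCat.hom_comp, LinearMap.comp_apply] at hmap
  exact hmap

/-- **Injectivity of `(Θ″_Y⁻¹)^*`** (`Θ″⁻¹ ≫ Θ″ = 𝟙`). [cite: GortzWedhorn2020, Prop. 4.16] -/
theorem injective_complexBetti_map_conjModelIso_inv (Y : SchemeOver L) (i : ℕ) :
    Function.Injective (complexBetti.map (baseChangeHomObjIsoOfComp (cmConjRingHom L) (ConjEmbedding.conjEmb ι₁) ι₁
        (conjEmb_comp_cmConjRingHom L ι₁) Y).inv i).hom := by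
  set Θ := baseChangeHomObjIsoOfComp (cmConjRingHom L) (ConjEmbedding.conjEmb ι₁) ι₁ (conjEmb_comp_cmConjRingHom L ι₁) Y
  intro z z' hzz'
  have h := congrArg (complexBetti.map Θ.hom i).hom hzz'
  have hid : complexBetti.map Θ.inv i ≫ complexBetti.map Θ.hom i = 𝟙 _ := by
    rw [← complexBetti.map_comp, Iso.hom_inv_id, complexBetti.map_id]
  have hz : (complexBetti.map Θ.hom i).hom ((complexBetti.map Θ.inv i).hom z) = z := by
    rw [← LinearMap.comp_apply, ← ModuleCat.hom_comp, hid]; rfl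
  have hz' : (complexBetti.map Θ.hom i).hom ((complexBetti.map Θ.inv i).hom z') = z' := by
    rw [← LinearMap.comp_apply, ← ModuleCat.hom_comp, hid]; rfl
  rw [hz, hz'] at h
  exact h

end ConjModel

/-! ## §2 Lemma 2.4 (1) on the GS levels ALONG `ῑ₁`, Hecke-natural -/

section GS

variable {F : CMField} {ι₁ : F →+* ℂ} {Jstar : Matrix (Fin 2) (Fin 2) (F : Type)}
  {K₀ : C5.OpenCompactSubgroup ↥(finAdelic ↥(maximalRealSubfield (F : Type)) (F : Type) (IsCMField.complexConj (F : Type)) 2 Jstar)}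
  (S : RecordSystemGS (F : Type) Jstar ι₁ K₀) (hU7ₛ : S.HeckeTranslateDefinedOver) (h4 : 4 ≤ Module.finrank ℚ (F : Type)) (isoₛ : ℕ → Prop)

/-- **Step (2), naturality along `ῑ₁`**: `albaneseH1Cmp^{ῑ₁} X_K A_K ((Alb T_g ⊗_{ῑ₁} ℂ)^* y) = (T.tr g ⊗_{ῑ₁} ℂ)(ℂ)^* (albaneseH1Cmp^{ῑ₁} X_{K'} A_{K'} y)`
(★ `albaneseH1Cmp_natural` at the α-compatible pair `(T.tr g, ∇(T.tr g), Alb(T_g))`, `τ′`-generic). [cite: Liu2021, Lem. 2.4 (1) with Def. 2.3; §4.2 l. 2074] -/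
theorem albaneseH1Cmp_albTr_conj (g : (sec42DataGS S h4 isoₛ).G) (K K' : C5.SmallLevel K₀) (h : C5.HeckeLE g K K')
    (y : (sec42DataGS S h4 isoₛ).bettiH1 (ConjEmbedding.conjEmb ι₁) K') :
    letI : Algebra (F : Type) ℂ := algebraAlong (F : Type) (ConjEmbedding.conjEmb ι₁)
    albaneseH1Cmp ((sec42DataGS S h4 isoₛ).X K) ((sec42DataGS S h4 isoₛ).alb K)
        (bettiPullAlong (ConjEmbedding.conjEmb ι₁) ((sec42HeckeTranslatesGS S hU7ₛ h4 isoₛ).albTr g K K' h) y) =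
      schemeBettiPullAlong (ConjEmbedding.conjEmb ι₁) ((sec42HeckeTranslatesGS S hU7ₛ h4 isoₛ).tr g K K' h)
        (albaneseH1Cmp ((sec42DataGS S h4 isoₛ).X K') ((sec42DataGS S h4 isoₛ).alb K') y) := by
  letI : Algebra (F : Type) ℂ := algebraAlong (F : Type) (ConjEmbedding.conjEmb ι₁)
  exact albaneseH1Cmp_natural ((sec42DataGS S h4 isoₛ).alb K) ((sec42DataGS S h4 isoₛ).alb K') _ _
    ((sec42DataGS S h4 isoₛ).cpt.smooth_X K) ((sec42DataGS S h4 isoₛ).cpt.projective_X K)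
    ((sec42DataGS S h4 isoₛ).cpt.smooth_X K') ((sec42DataGS S h4 isoₛ).cpt.projective_X K')
    ((sec42HeckeTranslatesGS S hU7ₛ h4 isoₛ).tr g K K' h) _ ((sec42HeckeTranslatesGS S hU7ₛ h4 isoₛ).albTr g K K' h)
    (((sec42DataGS S h4 isoₛ).alb K).nabla.map_incl ((sec42DataGS S h4 isoₛ).alb K').nabla
      ((sec42HeckeTranslatesGS S hU7ₛ h4 isoₛ).tr g K K' h))
    ((sec42HeckeTranslatesGS S hU7ₛ h4 isoₛ).α_albTr g K K' h) y

/-- **Step (2), injectivity along `ῑ₁`** for the curve tower (`n = 2` by `rfl`). [cite: Liu2021, Lem. 2.4 (1) (FJcycle.tex l. 1210–1213)] -/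
theorem injective_albaneseH1Cmp_conj (K : C5.SmallLevel K₀) :
    letI : Algebra (F : Type) ℂ := algebraAlong (F : Type) (ConjEmbedding.conjEmb ι₁)
    Function.Injective (albaneseH1Cmp ((sec42DataGS S h4 isoₛ).X K) ((sec42DataGS S h4 isoₛ).alb K)) :=
  sec42Data_injective_albaneseH1Cmp_of_n_eq_two (sec42DataGS S h4 isoₛ) rfl K

/-- **Step (1), naturality**: conjugation of points on the abelian varieties intertwines the two complexifications of `Alb(T_g)^*`:
`κ_{A_K} (Alb(T_g) ⊗_{ι₁} ℂ)^* y = (Alb(T_g) ⊗_{ῑ₁} ℂ)^* (κ_{A_{K'}} y)` (★ `ConjEmbedding.complexBettiConj_map_apply`; `bettiPullAlong = complexBetti.map`, rfl).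
[cite: Deligne1982HodgeCycles, §1 (p. 7)] -/
theorem complexBettiConj_bettiPullAlong (g : (sec42DataGS S h4 isoₛ).G) (K K' : C5.SmallLevel K₀) (h : C5.HeckeLE g K K')
    (y : (sec42DataGS S h4 isoₛ).bettiH1 ι₁ K') :
    (ConjEmbedding.complexBettiConj ι₁ ((sec42DataGS S h4 isoₛ).A K).X 1).hom
        (bettiPullAlong ι₁ ((sec42HeckeTranslatesGS S hU7ₛ h4 isoₛ).albTr g K K' h) y) =
      bettiPullAlong (ConjEmbedding.conjEmb ι₁) ((sec42HeckeTranslatesGS S hU7ₛ h4 isoₛ).albTr g K K' h)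
        ((ConjEmbedding.complexBettiConj ι₁ ((sec42DataGS S h4 isoₛ).A K').X 1).hom y) :=
  ConjEmbedding.complexBettiConj_map_apply ι₁ ((sec42HeckeTranslatesGS S hU7ₛ h4 isoₛ).albTr g K K' h).hom.hom.hom 1 y

end GS

/-! ## §3 The typed transport -/

section Transport

variable {F : CMField} {ι₁ : F →+* ℂ} {Jstar : Matrix (Fin 2) (Fin 2) (F : Type)}
  {K₀ : C5.OpenCompactSubgroup ↥(finAdelic ↥(maximalRealSubfield (F : Type)) (F : Type) (IsCMField.complexConj (F : Type)) 2 Jstar)}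
  (S : RecordSystemGS (F : Type) Jstar ι₁ K₀) (hU7ₛ : S.HeckeTranslateDefinedOver) (h4 : 4 ≤ Module.finrank ℚ (F : Type)) (isoₛ : ℕ → Prop)

set_option maxHeartbeats 400000 in  -- one `isDefEq` `(bcFunctor F ℂ).obj X_K ≡ (M_K ⊗_c F) ⊗_{ῑ₁} ℂ` through the `Sec42Data.ofAlbanese` projections (as the parent line's junction)
/-- **(α) — THE GS BETTI LEVELS EMBED HECKE-NATURALLY INTO THE RECORD's `H¹((M_K ⊗_{ι₁} ℂ)(ℂ); ℂ)` WITH HODGE TYPES REVERSED.**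
Granted [Deligne1979Valeurs, 0.2.5] (`ConjEmbedding.isOfHodgeType_conj_iff`): there are INJECTIVE `ℂ`-linear
`tr′_K : H¹_{B,ι₁}(A_K, ℂ) → H¹((M_K ⊗_{F,ι₁} ℂ)(ℂ); ℂ)` with `tr′_K (Alb(T_g)^* y) = (T_g ⊗_{ι₁} ℂ)(ℂ)^* (tr′_{K'} y)` for the record's
Hecke translates (the clause of ★ `exists_bettiLevelRecordTransport`, verbatim), such that for every class `y` of Hodge type `(p,q)` on
`A_K ⊗_{ι₁} ℂ` and every test morphism `φ : Z ⟶ M_K ⊗_{ι₁} ℂ` from a smooth projective `Z`, the class `φ^* (tr′_K y)` is of Hodge type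
`(q,p)` on `Z` — `tr′_K := (Θ″⁻¹)^* ∘ albaneseH1Cmp^{ῑ₁} ∘ κ_{A_K}`: conjugation of points on the abelian variety (types reversed), then the
algebraic maps `(α_{X_K})_x ⊗_{ῑ₁} ℂ` and `Θ″⁻¹` (types kept, [VoisinHodgeI2002, §7.3.2], along `φ ≫ Θ″⁻¹ ≫ (α_{X_K})_x`).
[cite: Deligne1979Valeurs, 0.2.5 (p. 315)] [cite: Liu2021, Lem. 2.4 (1) (FJcycle.tex l. 1210–1228); §4.2 l. 2064–2081]
[cite: VoisinHodgeI2002, §7.3.2] [cite: GortzWedhorn2020, Prop. 4.16] -/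
theorem exists_bettiLevelRecordTransport_hodge (hA1 : ConjEmbedding.isOfHodgeType_conj_iff) :
    ∃ tr : ∀ K : C5.SmallLevel K₀,
        (sec42DataGS S h4 isoₛ).bettiH1 ι₁ K →ₗ[ℂ] complexBetti ((baseChangeHom ι₁).obj (S.M.obj K)) 1,
      (∀ K, Function.Injective (tr K)) ∧
      (∀ (g : (sec42DataGS S h4 isoₛ).G) (K K' : C5.SmallLevel K₀) (h : C5.HeckeLE g K K')
        (y : (sec42DataGS S h4 isoₛ).bettiH1 ι₁ K'),
        tr K (bettiPullAlong ι₁ ((sec42HeckeTranslatesGS S hU7ₛ h4 isoₛ).albTr g K K' h) y) =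
          (complexBetti.map ((baseChangeHom ι₁).map (recordHeckeTranslateGS S hU7ₛ g K K' h)) 1).hom (tr K' y)) ∧
      ∀ (K : C5.SmallLevel K₀) (y : (sec42DataGS S h4 isoₛ).bettiH1 ι₁ K) (p q : ℕ),
        (letI : Algebra (F : Type) ℂ := algebraAlong (F : Type) ι₁
         IsOfHodgeType ((sec42DataGS S h4 isoₛ).A K).dim (((sec42DataGS S h4 isoₛ).A K).baseChange ℂ).X 1 p q y) →
        ∀ (Z : SchemeOver ℂ) (d : ℕ), IsSmoothProjective d Z → ∀ φ : Z ⟶ (baseChangeHom ι₁).obj (S.M.obj K),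
          IsOfHodgeType d Z 1 q p ((complexBetti.map φ 1).hom (tr K y)) := by
  -- the three steps as linear maps
  let e₁ : ∀ K : C5.SmallLevel K₀, (sec42DataGS S h4 isoₛ).bettiH1 ι₁ K →ₗ[ℂ]
      (sec42DataGS S h4 isoₛ).bettiH1 (ConjEmbedding.conjEmb ι₁) K :=
    fun K => (ConjEmbedding.complexBettiConj ι₁ ((sec42DataGS S h4 isoₛ).A K).X 1).hom.hom
  let e₂ : ∀ K : C5.SmallLevel K₀, (sec42DataGS S h4 isoₛ).bettiH1 (ConjEmbedding.conjEmb ι₁) K →ₗ[ℂ]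
      complexBetti ((baseChangeHom (ConjEmbedding.conjEmb ι₁)).obj
        ((baseChangeHom (cmConjRingHom (F : Type))).obj (S.M.obj K))) 1 :=
    fun K =>
      letI : Algebra (F : Type) ℂ := algebraAlong (F : Type) (ConjEmbedding.conjEmb ι₁)
      albaneseH1Cmp ((sec42DataGS S h4 isoₛ).X K) ((sec42DataGS S h4 isoₛ).alb K)
  let e₃ : ∀ K : C5.SmallLevel K₀,
      complexBetti ((baseChangeHom (ConjEmbedding.conjEmb ι₁)).obj
        ((baseChangeHom (cmConjRingHom (F : Type))).obj (S.M.obj K))) 1 →ₗ[ℂ]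
      complexBetti ((baseChangeHom ι₁).obj (S.M.obj K)) 1 :=
    fun K => (complexBetti.map (baseChangeHomObjIsoOfComp (cmConjRingHom (F : Type)) (ConjEmbedding.conjEmb ι₁) ι₁
      (conjEmb_comp_cmConjRingHom (F : Type) ι₁) (S.M.obj K)).inv 1).hom
  refine ⟨fun K => (e₃ K) ∘ₗ (e₂ K) ∘ₗ (e₁ K), fun K => ?_, fun g K K' h y => ?_, fun K y p q hy Z d hZ φ => ?_⟩
  · -- injective
    exact (injective_complexBetti_map_conjModelIso_inv (F : Type) ι₁ (S.M.obj K) 1).comp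
      ((injective_albaneseH1Cmp_conj S h4 isoₛ K).comp
        (ConjEmbedding.complexBettiConj ι₁ ((sec42DataGS S h4 isoₛ).A K).X 1).toLinearEquiv.injective)
  · -- Hecke-natural
    simp only [LinearMap.comp_apply]
    have h1 : e₁ K (bettiPullAlong ι₁ ((sec42HeckeTranslatesGS S hU7ₛ h4 isoₛ).albTr g K K' h) y) =
        bettiPullAlong (ConjEmbedding.conjEmb ι₁) ((sec42HeckeTranslatesGS S hU7ₛ h4 isoₛ).albTr g K K' h) (e₁ K' y) :=
      complexBettiConj_bettiPullAlong S hU7ₛ h4 isoₛ g K K' h y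
    rw [h1]
    have h2 : e₂ K (bettiPullAlong (ConjEmbedding.conjEmb ι₁) ((sec42HeckeTranslatesGS S hU7ₛ h4 isoₛ).albTr g K K' h) (e₁ K' y)) =
        (complexBetti.map ((baseChangeHom (ConjEmbedding.conjEmb ι₁)).map ((baseChangeHom (cmConjRingHom (F : Type))).map
          (recordHeckeTranslateGS S hU7ₛ g K K' h))) 1).hom (e₂ K' (e₁ K' y)) :=
      albaneseH1Cmp_albTr_conj S hU7ₛ h4 isoₛ g K K' h (e₁ K' y)
    rw [h2]
    exact complexBetti_map_conjModelIso_inv_natural (F : Type) ι₁ (recordHeckeTranslateGS S hU7ₛ g K K' h) 1 (e₂ K' (e₁ K' y))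
  · -- Hodge types reversed
    letI : Algebra (F : Type) ℂ := algebraAlong (F : Type) (ConjEmbedding.conjEmb ι₁)
    -- (A1) on the abelian variety `A_K`
    have hι : IsSmoothProjective ((sec42DataGS S h4 isoₛ).A K).dim ((baseChangeHom ι₁).obj ((sec42DataGS S h4 isoₛ).A K).X) := by
      letI : Algebra (F : Type) ℂ := algebraAlong (F : Type) ι₁
      exact isSmoothProjective_baseChange_complex ((sec42DataGS S h4 isoₛ).A K)
    have hῑ : IsSmoothProjective ((sec42DataGS S h4 isoₛ).A K).dim
        ((baseChangeHom (ConjEmbedding.conjEmb ι₁)).obj ((sec42DataGS S h4 isoₛ).A K).X) :=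
      isSmoothProjective_baseChange_complex ((sec42DataGS S h4 isoₛ).A K)
    have hc : IsOfHodgeType ((sec42DataGS S h4 isoₛ).A K).dim
        ((baseChangeHom (ConjEmbedding.conjEmb ι₁)).obj ((sec42DataGS S h4 isoₛ).A K).X) 1 q p (e₁ K y) :=
      (hA1 (F : Type) ι₁ ((sec42DataGS S h4 isoₛ).A K).X ((sec42DataGS S h4 isoₛ).A K).dim hι hῑ 1 p q y).mp hy
    -- the algebraic composite `φ ≫ Θ″⁻¹ ≫ (α_{X_K})_x`
    haveI : SmoothOfRelativeDimension 1 ((sec42DataGS S h4 isoₛ).X K).hom := (sec42DataGS S h4 isoₛ).cpt.smooth_X K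
    have hD : Nonempty (AlbanesePieces ((sec42DataGS S h4 isoₛ).X K)) :=
      nonempty_albanesePieces (d := 1) ((sec42DataGS S h4 isoₛ).X K) ((sec42DataGS S h4 isoₛ).cpt.projective_X K)
    have he₂ : e₂ K = (complexBetti.map ((Classical.choice hD).albAt ((sec42DataGS S h4 isoₛ).alb K)) 1).hom :=
      albaneseH1Cmp_eq ((sec42DataGS S h4 isoₛ).X K) ((sec42DataGS S h4 isoₛ).alb K) hD
    have hcomp : (complexBetti.map φ 1).hom (((e₃ K) ∘ₗ (e₂ K) ∘ₗ (e₁ K)) y) =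
        (complexBetti.map (φ ≫ (baseChangeHomObjIsoOfComp (cmConjRingHom (F : Type)) (ConjEmbedding.conjEmb ι₁) ι₁
          (conjEmb_comp_cmConjRingHom (F : Type) ι₁) (S.M.obj K)).inv ≫
          (Classical.choice hD).albAt ((sec42DataGS S h4 isoₛ).alb K)) 1).hom (e₁ K y) := by
      rw [LinearMap.comp_apply, LinearMap.comp_apply, he₂]
      simp only [complexBetti.map_comp, ModuleCat.hom_comp, LinearMap.comp_apply]
      rfl
    rw [hcomp]
    exact hc.map_of_isSmoothProjective hZ hῑ _

end Transport

end Summit.HodgeConjecture.HodgeConjecture.Cruxes.HLiu418.BettiLevelRecordTransportHodge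

end
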